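import Mathlib.Tactic.Ring
import Mathlib.Tactic.Linarith
import HarnessLib

/-!
# Venture HSemireg — the INCIDENCE STEPS of THEOREM H-FOOT: partners, footprints and the rectangle step produce the footprint family of the COVER LEMMA

Companion to `AdditiveFootprintCover.lean` (the COVER LEMMA, k = 454), `AdditiveCrossDecomposition.lean` (H-CROSS, k = 350),
`NetPropagation.lean` (k = 252) and `LayerBlocks.lean` (k = 269) — cell pub-hsemireg, seat p2 gen 16, note
`p2/wlaws/GLUING16-p2g16.md` §6 «THEOREM H-FOOT», steps (0)–(2); bus G16-RESULT 1.

SETTING (there, in the vocabulary of `NetPropagation.lean`).  One layer over a sloped slot-3 line `m`: slot-1 points `P₁` and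
lines `L₁`, slot-2 points `P₂` and lines `L₂`, incidences `on₁`, `on₂`; `T x y` = «the triple (x, y, m) lies in Z»; `A p`,
`A' q` = «the A-pad at p ∕ the A′-pad at q lies in Z»; every line has a DIRECTION `dir₁ x : Option S` (`none` = axis line,
`some σ` = sloped of direction `σ`; `S` = the three sloped directions of the cube alphabet).  Weights: `w x y` of the triple,
`a p`, `a' q` of the pads.  The tier facts of the note enter as hypotheses:
* geometry of lines: a sloped line meets every other line that is not sloped of the same direction (`meet₁`, `meet₂`), and
  two distinct sloped lines of the same direction are disjoint (`par₁`, `par₂`);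
* (A·A′): through a point pair `(p, q)` carrying both pads pass at most two layer triples (`two₁`), and a layer triple through
  such a pair has a CROSSED partner there (`partner`);
* (X·A) ∕ (X·A′): a crossed pair of layer triples through `(p, q)` plus one pad gives the other pad (`crossA`, `crossA'` —
  literally the hypotheses of `NetPropagation.net_of_axis_partner` ∕ `FibrePartition.lean`);
* ADDITIVITY of the weighting at the doubly-footed curves: for two crossed layer triples through a point pair carrying both
  pads, `w r c + w x y = a p + a' q` (`add`);
* LAYER BLOCKS (a)(b) with BALANCE (THEOREM F's tier): every sloped–sloped layer triple lies in a linked rectangle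
  `D* × C* ⊆ T` whose rows and whose columns show all three directions (`blocks`);
* the rectangle under study: `D × C ⊆ T` with sloped rows and columns of directions `sR`, `sC`, all three directions present
  on each side (`balR`, `balC`), a third direction always available (`three`), and (rows): every row has an A-foot and every
  column an A′-foot (`footR`, `footC`).

THIS FILE proves, from these hypotheses alone, the three support-side hypotheses of the COVER LEMMA for the footprint family
`Φ oσ oτ` := «some crossed partner `(x, y)` at a doubly-footed curve of some cell of `D × C` has `dir₁ x = oσ`, `dir₂ y = oτ`»:
`wit` (the 2 × 2 interactions of `w` vanish on «rows not parallel to `x`» × «columns not parallel to `y`» — step (1)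
FOOTPRINTS), `cover` (every cell lies in a footprint — step (0) PARTNERS) and `closure` (one sloped–sloped partner gives all
nine sloped–sloped shapes — step (2) CLOSURE UNDER RECTANGLES): theorem `footprint_family`.  Feeding it to
`AdditiveFootprintCover.exists_row_add_col_of_cover` gives `w r c = f r + g c` on `D × C`, and then
`AdditiveCrossDecomposition.rect_class_dead` gives «additive ⇒ class-dead» on the rectangle: THEOREM H-FOOT as a tree theorem
modulo the listed incidence hypotheses (this file does not import those two leaves, so that it stays free of build order; the
composition is a one-line application).
What the kernel certifies: the incidence bookkeeping of steps (0)–(2); what it does not: that a given support satisfies the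
hypotheses (the catalogue facts (A·A′), (X·A)∕(X·A′), LAYER BLOCKS and balance are hand ∕ census statements of the notes).

HONEST FRAMING. Finite incidence bookkeeping over the integers; no variety, cycle, cohomology class or semiregularity map
occurs; nothing here bears on HC ∕ HC_CM ∕ HC_AV.
-/

namespace Summit.Ventures.HSemireg
namespace AdditiveFootprintIncidence

variable {P₁ P₂ L₁ L₂ S : Type*}
variable (T : L₁ → L₂ → Prop) (A : P₁ → Prop) (A' : P₂ → Prop) (on₁ : P₁ → L₁ → Prop) (on₂ : P₂ → L₂ → Prop)
  (dir₁ : L₁ → Option S) (dir₂ : L₂ → Option S) (w : L₁ → L₂ → ℤ) (a : P₁ → ℤ) (a' : P₂ → ℤ)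
  (D : L₁ → Prop) (C : L₂ → Prop) (sR : {r // D r} → S) (sC : {c // C c} → S)

/-! ### Step (0): partners lie outside the rectangle -/

/-- Step (0), slot 1: if `(x, y)` is a crossed partner of the cell `(r, c)` at a point pair `(p, q)` carrying both pads, then
`x` is not a row of the rectangle `D × C ⊆ T` (no third layer triple through a doubly-padded point pair, by (A·A′) `two₁`). -/
theorem partner_ne_row
    (two₁ : ∀ p q r c x y u v, A p → A' q → T r c → T x y → T u v → x ≠ r →
      on₁ p r → on₂ q c → on₁ p x → on₂ q y → on₁ p u → on₂ q v → (u = r ∧ v = c) ∨ (u = x ∧ v = y))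
    (rect : ∀ r c, D r → C c → T r c)
    {x r : L₁} {y c : L₂} {p : P₁} {q : P₂} (hr : D r) (hc : C c) (hT : T x y) (hxr : x ≠ r) (hyc : y ≠ c)
    (hpr : on₁ p r) (hpx : on₁ p x) (hqc : on₂ q c) (hqy : on₂ q y) (hA : A p) (hA' : A' q)
    {r₁ : L₁} (hr₁ : D r₁) : x ≠ r₁ := by
  intro e
  subst e
  rcases two₁ p q r c x y x c hA hA' (rect r c hr hc) hT (rect x c hr₁ hc) hxr hpr hqc hpx hqy hpx hqc
    with ⟨e₁, -⟩ | ⟨-, e₂⟩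
  · exact hxr e₁
  · exact hyc e₂.symm

/-- Step (0), slot 2: symmetrically, the partner's slot-2 line is not a column of the rectangle. -/
theorem partner_ne_col
    (two₁ : ∀ p q r c x y u v, A p → A' q → T r c → T x y → T u v → x ≠ r →
      on₁ p r → on₂ q c → on₁ p x → on₂ q y → on₁ p u → on₂ q v → (u = r ∧ v = c) ∨ (u = x ∧ v = y))
    (rect : ∀ r c, D r → C c → T r c)
    {x r : L₁} {y c : L₂} {p : P₁} {q : P₂} (hr : D r) (hc : C c) (hT : T x y) (hxr : x ≠ r) (hyc : y ≠ c)
    (hpr : on₁ p r) (hpx : on₁ p x) (hqc : on₂ q c) (hqy : on₂ q y) (hA : A p) (hA' : A' q)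
    {c₁ : L₂} (hc₁ : C c₁) : y ≠ c₁ := by
  intro e
  subst e
  rcases two₁ p q r c x y r y hA hA' (rect r c hr hc) hT (rect r y hr hc₁) hxr hpr hqc hpx hqy hpr hqy
    with ⟨-, e₂⟩ | ⟨e₁, -⟩
  · exact hyc e₂
  · exact hxr e₁.symm

/-! ### Step (1): footprints -/

/-- Step (1), slot 1: every row `r₁` not parallel to the partner line `x` meets `x` in an A-FOOT — by `meet₁` and (X·A′)
`crossA'` applied to the crossed pair `(x, y)`, `(r₁, c)` through `(x ∩ r₁, q)` with the A′-pad at `q`. -/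
theorem foot_on_row
    (meet₁ : ∀ x r σ, x ≠ r → dir₁ r = some σ → dir₁ x ≠ some σ → ∃ p, on₁ p x ∧ on₁ p r)
    (two₁ : ∀ p q r c x y u v, A p → A' q → T r c → T x y → T u v → x ≠ r →
      on₁ p r → on₂ q c → on₁ p x → on₂ q y → on₁ p u → on₂ q v → (u = r ∧ v = c) ∨ (u = x ∧ v = y))
    (crossA' : ∀ x x' y y' p q, T x y → T x' y' → x ≠ x' → y ≠ y' →
      on₁ p x → on₁ p x' → on₂ q y → on₂ q y' → A' q → A p)
    (rect : ∀ r c, D r → C c → T r c) (hsR : ∀ r, dir₁ r.1 = some (sR r))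
    {x r : L₁} {y c : L₂} {p : P₁} {q : P₂} (hr : D r) (hc : C c) (hT : T x y) (hxr : x ≠ r) (hyc : y ≠ c)
    (hpr : on₁ p r) (hpx : on₁ p x) (hqc : on₂ q c) (hqy : on₂ q y) (hA : A p) (hA' : A' q)
    (r₁ : {r // D r}) (hdir : ∀ σ, dir₁ x = some σ → sR r₁ ≠ σ) :
    ∃ p₁, on₁ p₁ x ∧ on₁ p₁ r₁.1 ∧ A p₁ := by
  have hne : x ≠ r₁.1 :=
    partner_ne_row T A A' on₁ on₂ D C two₁ rect hr hc hT hxr hyc hpr hpx hqc hqy hA hA' r₁.2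
  have hdx : dir₁ x ≠ some (sR r₁) := fun e => hdir _ e rfl
  obtain ⟨p₁, hp₁x, hp₁r⟩ := meet₁ x r₁.1 (sR r₁) hne (hsR r₁) hdx
  exact ⟨p₁, hp₁x, hp₁r, crossA' x r₁.1 y c p₁ q hT (rect _ _ r₁.2 hc) hne hyc hp₁x hp₁r hqy hqc hA'⟩

/-- Step (1), slot 2: every column `c₁` not parallel to the partner line `y` meets `y` in an A′-FOOT (by `meet₂` and (X·A)). -/
theorem foot_on_col
    (meet₂ : ∀ y c τ, y ≠ c → dir₂ c = some τ → dir₂ y ≠ some τ → ∃ q, on₂ q y ∧ on₂ q c)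
    (two₁ : ∀ p q r c x y u v, A p → A' q → T r c → T x y → T u v → x ≠ r →
      on₁ p r → on₂ q c → on₁ p x → on₂ q y → on₁ p u → on₂ q v → (u = r ∧ v = c) ∨ (u = x ∧ v = y))
    (crossA : ∀ x x' y y' p q, T x y → T x' y' → x ≠ x' → y ≠ y' →
      on₁ p x → on₁ p x' → on₂ q y → on₂ q y' → A p → A' q)
    (rect : ∀ r c, D r → C c → T r c) (hsC : ∀ c, dir₂ c.1 = some (sC c))
    {x r : L₁} {y c : L₂} {p : P₁} {q : P₂} (hr : D r) (hc : C c) (hT : T x y) (hxr : x ≠ r) (hyc : y ≠ c)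
    (hpr : on₁ p r) (hpx : on₁ p x) (hqc : on₂ q c) (hqy : on₂ q y) (hA : A p) (hA' : A' q)
    (c₁ : {c // C c}) (hdir : ∀ τ, dir₂ y = some τ → sC c₁ ≠ τ) :
    ∃ q₁, on₂ q₁ y ∧ on₂ q₁ c₁.1 ∧ A' q₁ := by
  have hne : y ≠ c₁.1 :=
    partner_ne_col T A A' on₁ on₂ D C two₁ rect hr hc hT hxr hyc hpr hpx hqc hqy hA hA' c₁.2
  have hdy : dir₂ y ≠ some (sC c₁) := fun e => hdir _ e rfl
  obtain ⟨q₁, hq₁y, hq₁c⟩ := meet₂ y c₁.1 (sC c₁) hne (hsC c₁) hdy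
  exact ⟨q₁, hq₁y, hq₁c, crossA x r y c₁.1 p q₁ hT (rect _ _ hr c₁.2) hxr hne hpx hpr hq₁y hq₁c hA⟩

/-- Step (1), FOOTPRINTS: on «rows not parallel to `x`» × «columns not parallel to `y`» an ADDITIVE weighting is
`w r₁ c₁ = a (x ∩ r₁) + a' (y ∩ c₁) − w x y`, so every 2 × 2 interaction of `w` vanishes there. -/
theorem interaction_zero_on_footprint
    (meet₁ : ∀ x r σ, x ≠ r → dir₁ r = some σ → dir₁ x ≠ some σ → ∃ p, on₁ p x ∧ on₁ p r)
    (meet₂ : ∀ y c τ, y ≠ c → dir₂ c = some τ → dir₂ y ≠ some τ → ∃ q, on₂ q y ∧ on₂ q c)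
    (two₁ : ∀ p q r c x y u v, A p → A' q → T r c → T x y → T u v → x ≠ r →
      on₁ p r → on₂ q c → on₁ p x → on₂ q y → on₁ p u → on₂ q v → (u = r ∧ v = c) ∨ (u = x ∧ v = y))
    (crossA : ∀ x x' y y' p q, T x y → T x' y' → x ≠ x' → y ≠ y' →
      on₁ p x → on₁ p x' → on₂ q y → on₂ q y' → A p → A' q)
    (crossA' : ∀ x x' y y' p q, T x y → T x' y' → x ≠ x' → y ≠ y' →
      on₁ p x → on₁ p x' → on₂ q y → on₂ q y' → A' q → A p)
    (add : ∀ p q r c x y, A p → A' q → T r c → T x y → x ≠ r → y ≠ c →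
      on₁ p r → on₂ q c → on₁ p x → on₂ q y → w r c + w x y = a p + a' q)
    (rect : ∀ r c, D r → C c → T r c) (hsR : ∀ r, dir₁ r.1 = some (sR r)) (hsC : ∀ c, dir₂ c.1 = some (sC c))
    {x r : L₁} {y c : L₂} {p : P₁} {q : P₂} (hr : D r) (hc : C c) (hT : T x y) (hxr : x ≠ r) (hyc : y ≠ c)
    (hpr : on₁ p r) (hpx : on₁ p x) (hqc : on₂ q c) (hqy : on₂ q y) (hA : A p) (hA' : A' q)
    (r₁ r₂ : {r // D r}) (c₁ c₂ : {c // C c})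
    (h₁ : ∀ σ, dir₁ x = some σ → sR r₁ ≠ σ) (h₂ : ∀ σ, dir₁ x = some σ → sR r₂ ≠ σ)
    (h₃ : ∀ τ, dir₂ y = some τ → sC c₁ ≠ τ) (h₄ : ∀ τ, dir₂ y = some τ → sC c₂ ≠ τ) :
    w r₁.1 c₁.1 - w r₁.1 c₂.1 - w r₂.1 c₁.1 + w r₂.1 c₂.1 = 0 := by
  obtain ⟨p₁, hp₁x, hp₁r, hAp₁⟩ :=
    foot_on_row T A A' on₁ on₂ dir₁ D C sR meet₁ two₁ crossA' rect hsR hr hc hT hxr hyc hpr hpx hqc hqy hA hA' r₁ h₁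
  obtain ⟨p₂, hp₂x, hp₂r, hAp₂⟩ :=
    foot_on_row T A A' on₁ on₂ dir₁ D C sR meet₁ two₁ crossA' rect hsR hr hc hT hxr hyc hpr hpx hqc hqy hA hA' r₂ h₂
  obtain ⟨q₁, hq₁y, hq₁c, hAq₁⟩ :=
    foot_on_col T A A' on₁ on₂ dir₂ D C sC meet₂ two₁ crossA rect hsC hr hc hT hxr hyc hpr hpx hqc hqy hA hA' c₁ h₃
  obtain ⟨q₂, hq₂y, hq₂c, hAq₂⟩ :=
    foot_on_col T A A' on₁ on₂ dir₂ D C sC meet₂ two₁ crossA rect hsC hr hc hT hxr hyc hpr hpx hqc hqy hA hA' c₂ h₄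
  have hx₁ : x ≠ r₁.1 := partner_ne_row T A A' on₁ on₂ D C two₁ rect hr hc hT hxr hyc hpr hpx hqc hqy hA hA' r₁.2
  have hx₂ : x ≠ r₂.1 := partner_ne_row T A A' on₁ on₂ D C two₁ rect hr hc hT hxr hyc hpr hpx hqc hqy hA hA' r₂.2
  have hy₁ : y ≠ c₁.1 := partner_ne_col T A A' on₁ on₂ D C two₁ rect hr hc hT hxr hyc hpr hpx hqc hqy hA hA' c₁.2
  have hy₂ : y ≠ c₂.1 := partner_ne_col T A A' on₁ on₂ D C two₁ rect hr hc hT hxr hyc hpr hpx hqc hqy hA hA' c₂.2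
  have e₁₁ := add p₁ q₁ r₁.1 c₁.1 x y hAp₁ hAq₁ (rect _ _ r₁.2 c₁.2) hT hx₁ hy₁ hp₁r hq₁c hp₁x hq₁y
  have e₁₂ := add p₁ q₂ r₁.1 c₂.1 x y hAp₁ hAq₂ (rect _ _ r₁.2 c₂.2) hT hx₁ hy₂ hp₁r hq₂c hp₁x hq₂y
  have e₂₁ := add p₂ q₁ r₂.1 c₁.1 x y hAp₂ hAq₁ (rect _ _ r₂.2 c₁.2) hT hx₂ hy₁ hp₂r hq₁c hp₂x hq₁y
  have e₂₂ := add p₂ q₂ r₂.1 c₂.1 x y hAp₂ hAq₂ (rect _ _ r₂.2 c₂.2) hT hx₂ hy₂ hp₂r hq₂c hp₂x hq₂y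
  linarith

/-! ### Step (2): closure under rectangles -/

/-- Step (2), one move in slot 1: if `(x, y)` is a sloped partner of the cell `(r, c)` at `(p, q)` and `(x', y)` is a layer
triple with `x'` sloped, then `x'` is again a partner — of the cell `(r', c)` for a row `r'` of a third direction, at the point
pair `(x' ∩ r', q)` (its A-pad comes from (X·A′)). -/
theorem partner_step_row
    (meet₁ : ∀ x r σ, x ≠ r → dir₁ r = some σ → dir₁ x ≠ some σ → ∃ p, on₁ p x ∧ on₁ p r)
    (two₁ : ∀ p q r c x y u v, A p → A' q → T r c → T x y → T u v → x ≠ r →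
      on₁ p r → on₂ q c → on₁ p x → on₂ q y → on₁ p u → on₂ q v → (u = r ∧ v = c) ∨ (u = x ∧ v = y))
    (crossA' : ∀ x x' y y' p q, T x y → T x' y' → x ≠ x' → y ≠ y' →
      on₁ p x → on₁ p x' → on₂ q y → on₂ q y' → A' q → A p)
    (rect : ∀ r c, D r → C c → T r c) (hsR : ∀ r, dir₁ r.1 = some (sR r))
    (balR : ∀ σ, ∃ r, sR r = σ) (three : ∀ i j : S, ∃ k, k ≠ i ∧ k ≠ j)
    {x r : L₁} {y c : L₂} {p : P₁} {q : P₂} (hr : D r) (hc : C c) (hT : T x y) (hxr : x ≠ r) (hyc : y ≠ c)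
    (hpr : on₁ p r) (hpx : on₁ p x) (hqc : on₂ q c) (hqy : on₂ q y) (hA : A p) (hA' : A' q)
    {σ : S} (hx : dir₁ x = some σ) {x' : L₁} (hTx'y : T x' y) {σ' : S} (hx' : dir₁ x' = some σ') :
    ∃ r' p', D r' ∧ x' ≠ r' ∧ on₁ p' r' ∧ on₁ p' x' ∧ A p' := by
  obtain ⟨k, hkσ, hkσ'⟩ := three σ σ'
  obtain ⟨r', hr'⟩ := balR k
  obtain ⟨p₁, hp₁x, hp₁r, hAp₁⟩ :=
    foot_on_row T A A' on₁ on₂ dir₁ D C sR meet₁ two₁ crossA' rect hsR hr hc hT hxr hyc hpr hpx hqc hqy hA hA' r'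
      (fun σ₀ e => by rw [hx] at e; cases e; rw [hr']; exact hkσ)
  have hxr' : x ≠ r'.1 := partner_ne_row T A A' on₁ on₂ D C two₁ rect hr hc hT hxr hyc hpr hpx hqc hqy hA hA' r'.2
  -- x' is not the row r': else (r', y) would be a third layer triple through (p₁, q)
  have hx'r' : x' ≠ r'.1 := by
    intro e
    subst e
    rcases two₁ p₁ q r'.1 c x y r'.1 y hAp₁ hA' (rect _ _ r'.2 hc) hT hTx'y hxr' hp₁r hqc hp₁x hqy hp₁r hqy
      with ⟨-, e₂⟩ | ⟨e₁, -⟩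
    · exact hyc e₂
    · exact hxr' e₁.symm
  have hdx' : dir₁ x' ≠ some (sR r') := by
    rw [hx', hr']
    exact fun e => hkσ' (Option.some.inj e).symm
  obtain ⟨p', hp'x', hp'r'⟩ := meet₁ x' r'.1 (sR r') hx'r' (hsR r') hdx'
  exact ⟨r'.1, p', r'.2, hx'r', hp'r', hp'x',
    crossA' x' r'.1 y c p' q hTx'y (rect _ _ r'.2 hc) hx'r' hyc hp'x' hp'r' hqy hqc hA'⟩

/-- Step (2), one move in slot 2 (mirror of `partner_step_row`, by (X·A)). -/
theorem partner_step_col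
    (meet₂ : ∀ y c τ, y ≠ c → dir₂ c = some τ → dir₂ y ≠ some τ → ∃ q, on₂ q y ∧ on₂ q c)
    (two₁ : ∀ p q r c x y u v, A p → A' q → T r c → T x y → T u v → x ≠ r →
      on₁ p r → on₂ q c → on₁ p x → on₂ q y → on₁ p u → on₂ q v → (u = r ∧ v = c) ∨ (u = x ∧ v = y))
    (crossA : ∀ x x' y y' p q, T x y → T x' y' → x ≠ x' → y ≠ y' →
      on₁ p x → on₁ p x' → on₂ q y → on₂ q y' → A p → A' q)
    (rect : ∀ r c, D r → C c → T r c) (hsC : ∀ c, dir₂ c.1 = some (sC c))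
    (balC : ∀ τ, ∃ c, sC c = τ) (three : ∀ i j : S, ∃ k, k ≠ i ∧ k ≠ j)
    {x r : L₁} {y c : L₂} {p : P₁} {q : P₂} (hr : D r) (hc : C c) (hT : T x y) (hxr : x ≠ r) (hyc : y ≠ c)
    (hpr : on₁ p r) (hpx : on₁ p x) (hqc : on₂ q c) (hqy : on₂ q y) (hA : A p) (hA' : A' q)
    {τ : S} (hy : dir₂ y = some τ) {y' : L₂} (hTxy' : T x y') {τ' : S} (hy' : dir₂ y' = some τ') :
    ∃ c' q', C c' ∧ y' ≠ c' ∧ on₂ q' c' ∧ on₂ q' y' ∧ A' q' := by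
  obtain ⟨l, hlτ, hlτ'⟩ := three τ τ'
  obtain ⟨c', hc'⟩ := balC l
  obtain ⟨q₁, hq₁y, hq₁c, hAq₁⟩ :=
    foot_on_col T A A' on₁ on₂ dir₂ D C sC meet₂ two₁ crossA rect hsC hr hc hT hxr hyc hpr hpx hqc hqy hA hA' c'
      (fun τ₀ e => by rw [hy] at e; cases e; rw [hc']; exact hlτ)
  have hyc' : y ≠ c'.1 := partner_ne_col T A A' on₁ on₂ D C two₁ rect hr hc hT hxr hyc hpr hpx hqc hqy hA hA' c'.2
  have hy'c' : y' ≠ c'.1 := by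
    intro e
    subst e
    rcases two₁ p q₁ r c'.1 x y x c'.1 hA hAq₁ (rect _ _ hr c'.2) hT hTxy' hxr hpr hq₁c hpx hq₁y hpx hq₁c
      with ⟨e₁, -⟩ | ⟨-, e₂⟩
    · exact hxr e₁
    · exact hyc' e₂.symm
  have hdy' : dir₂ y' ≠ some (sC c') := by
    rw [hy', hc']
    exact fun e => hlτ' (Option.some.inj e).symm
  obtain ⟨q', hq'y', hq'c'⟩ := meet₂ y' c'.1 (sC c') hy'c' (hsC c') hdy'
  exact ⟨c'.1, q', c'.2, hy'c', hq'c', hq'y',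
    crossA x r y' c'.1 p q' hTxy' (rect _ _ hr c'.2) hxr hy'c' hpx hpr hq'y' hq'c' hA⟩

/-! ### The footprint family -/

/-- **THE FOOTPRINT FAMILY (steps (0)–(2) of THEOREM H-FOOT).**  Layer data `T, A, A', on₁, on₂, dir₁, dir₂`, weights
`w, a, a'`, a rectangle `D × C ⊆ T` with sloped rows ∕ columns of directions `sR`, `sC`.  Hypotheses: line geometry
(`meet₁`, `meet₂`, `par₁`, `par₂`), (A·A′) (`two₁`, `partner`), (X·A) ∕ (X·A′) (`crossA`, `crossA'`), ADDITIVITY at the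
doubly-footed curves (`add`), LAYER BLOCKS with balance (`blocks`), the rectangle's balance (`balR`, `balC`, `three`) and
(rows) (`footR`, `footC`).  CONCLUSION: there is a footprint family `Φ : Option S → Option S → Prop` (namely «some crossed
partner at a doubly-footed curve of some cell has these line directions») satisfying the three support-side hypotheses
`wit`, `cover`, `closure` of `AdditiveFootprintCover.interaction_zero_of_cover` ∕ `exists_row_add_col_of_cover` (with
`R = {r // D r}`, `C = {c // C c}`, weight `fun r c => w r.1 c.1`); with `three`, `balR`, `balC` that lemma yields
`w = f(row) + g(column)` on `D × C`, and `AdditiveCrossDecomposition.rect_class_dead` then gives «additive ⇒ class-dead». -/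
theorem footprint_family
    (meet₁ : ∀ x r σ, x ≠ r → dir₁ r = some σ → dir₁ x ≠ some σ → ∃ p, on₁ p x ∧ on₁ p r)
    (meet₂ : ∀ y c τ, y ≠ c → dir₂ c = some τ → dir₂ y ≠ some τ → ∃ q, on₂ q y ∧ on₂ q c)
    (par₁ : ∀ x r σ p, x ≠ r → dir₁ x = some σ → dir₁ r = some σ → on₁ p x → on₁ p r → False)
    (par₂ : ∀ y c τ q, y ≠ c → dir₂ y = some τ → dir₂ c = some τ → on₂ q y → on₂ q c → False)
    (two₁ : ∀ p q r c x y u v, A p → A' q → T r c → T x y → T u v → x ≠ r →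
      on₁ p r → on₂ q c → on₁ p x → on₂ q y → on₁ p u → on₂ q v → (u = r ∧ v = c) ∨ (u = x ∧ v = y))
    (partner : ∀ p q r c, A p → A' q → T r c → on₁ p r → on₂ q c →
      ∃ x y, T x y ∧ x ≠ r ∧ y ≠ c ∧ on₁ p x ∧ on₂ q y)
    (crossA : ∀ x x' y y' p q, T x y → T x' y' → x ≠ x' → y ≠ y' →
      on₁ p x → on₁ p x' → on₂ q y → on₂ q y' → A p → A' q)
    (crossA' : ∀ x x' y y' p q, T x y → T x' y' → x ≠ x' → y ≠ y' →
      on₁ p x → on₁ p x' → on₂ q y → on₂ q y' → A' q → A p)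
    (add : ∀ p q r c x y, A p → A' q → T r c → T x y → x ≠ r → y ≠ c →
      on₁ p r → on₂ q c → on₁ p x → on₂ q y → w r c + w x y = a p + a' q)
    (blocks : ∀ x y σ τ, T x y → dir₁ x = some σ → dir₂ y = some τ →
      ∃ (Ds : L₁ → Prop) (Cs : L₂ → Prop), Ds x ∧ Cs y ∧ (∀ x' y', Ds x' → Cs y' → T x' y') ∧
        (∀ σ', ∃ x', Ds x' ∧ dir₁ x' = some σ') ∧ (∀ τ', ∃ y', Cs y' ∧ dir₂ y' = some τ'))
    (rect : ∀ r c, D r → C c → T r c) (hsR : ∀ r, dir₁ r.1 = some (sR r)) (hsC : ∀ c, dir₂ c.1 = some (sC c))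
    (balR : ∀ σ, ∃ r, sR r = σ) (balC : ∀ τ, ∃ c, sC c = τ) (three : ∀ i j : S, ∃ k, k ≠ i ∧ k ≠ j)
    (footR : ∀ r, D r → ∃ p, on₁ p r ∧ A p) (footC : ∀ c, C c → ∃ q, on₂ q c ∧ A' q) :
    ∃ Φ : Option S → Option S → Prop,
      (∀ oσ oτ, Φ oσ oτ → ∀ (r r' : {r // D r}) (c c' : {c // C c}),
        (∀ σ, oσ = some σ → sR r ≠ σ) → (∀ σ, oσ = some σ → sR r' ≠ σ) →
        (∀ τ, oτ = some τ → sC c ≠ τ) → (∀ τ, oτ = some τ → sC c' ≠ τ) →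
        w r.1 c.1 - w r.1 c'.1 - w r'.1 c.1 + w r'.1 c'.1 = 0) ∧
      (∀ (r : {r // D r}) (c : {c // C c}), ∃ oσ oτ, Φ oσ oτ ∧
        (∀ σ, oσ = some σ → sR r ≠ σ) ∧ (∀ τ, oτ = some τ → sC c ≠ τ)) ∧
      ((∃ σ τ, Φ (some σ) (some τ)) → ∀ σ τ, Φ (some σ) (some τ)) := by
  -- the footprint family: directions of crossed partners at doubly-footed curves of cells
  refine ⟨fun oσ oτ => ∃ x y r c p q, D r ∧ C c ∧ T x y ∧ x ≠ r ∧ y ≠ c ∧ on₁ p r ∧ on₁ p x ∧ on₂ q c ∧ on₂ q y ∧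
      A p ∧ A' q ∧ dir₁ x = oσ ∧ dir₂ y = oτ, ?_, ?_, ?_⟩
  · -- `wit`: step (1)
    rintro oσ oτ ⟨x, y, r₀, c₀, p, q, hr, hc, hT, hxr, hyc, hpr, hpx, hqc, hqy, hA, hA', hx, hy⟩ r r' c c' h₁ h₂ h₃ h₄
    exact interaction_zero_on_footprint T A A' on₁ on₂ dir₁ dir₂ w a a' D C sR sC meet₁ meet₂ two₁ crossA crossA' add
      rect hsR hsC hr hc hT hxr hyc hpr hpx hqc hqy hA hA' r r' c c'
      (fun σ e => h₁ σ (hx ▸ e)) (fun σ e => h₂ σ (hx ▸ e)) (fun τ e => h₃ τ (hy ▸ e)) (fun τ e => h₄ τ (hy ▸ e))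
  · -- `cover`: step (0) — (rows) gives the feet, (A·A′) the crossed partner, `par` puts the cell in its footprint
    intro r c
    obtain ⟨p, hpr, hA⟩ := footR r.1 r.2
    obtain ⟨q, hqc, hA'⟩ := footC c.1 c.2
    obtain ⟨x, y, hT, hxr, hyc, hpx, hqy⟩ := partner p q r.1 c.1 hA hA' (rect _ _ r.2 c.2) hpr hqc
    refine ⟨dir₁ x, dir₂ y, ⟨x, y, r.1, c.1, p, q, r.2, c.2, hT, hxr, hyc, hpr, hpx, hqc, hqy, hA, hA', rfl, rfl⟩, ?_, ?_⟩
    · intro σ hσ e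
      exact par₁ x r.1 σ p hxr hσ (e ▸ hsR r) hpx hpr
    · intro τ hτ e
      exact par₂ y c.1 τ q hyc hτ (e ▸ hsC c) hqy hqc
  · -- `closure`: step (2) — the block rectangle of a sloped–sloped partner is balanced and consists of partners
    rintro ⟨σ, τ, x, y, r, c, p, q, hr, hc, hT, hxr, hyc, hpr, hpx, hqc, hqy, hA, hA', hx, hy⟩ σ' τ'
    obtain ⟨Ds, Cs, hxD, hyC, hTs, hbalD, hbalC⟩ := blocks x y σ τ hT hx hy
    obtain ⟨x', hx'D, hx'⟩ := hbalD σ'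
    obtain ⟨y', hy'C, hy'⟩ := hbalC τ'
    obtain ⟨r', p', hr', hx'r', hp'r', hp'x', hAp'⟩ :=
      partner_step_row T A A' on₁ on₂ dir₁ D C sR meet₁ two₁ crossA' rect hsR balR three hr hc hT hxr hyc hpr hpx hqc hqy
        hA hA' hx (hTs x' y hx'D hyC) hx'
    -- (x', y) is a partner of (r', c) at (p', q); now move in slot 2 from it
    obtain ⟨c', q', hc', hy'c', hq'c', hq'y', hAq'⟩ :=
      partner_step_col T A A' on₁ on₂ dir₂ D C sC meet₂ two₁ crossA rect hsC balC three hr' hc (hTs x' y hx'D hyC) hx'r'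
        hyc hp'r' hp'x' hqc hqy hAp' hA' hy (hTs x' y' hx'D hy'C) hy'
    exact ⟨x', y', r', c', p', q', hr', hc', hTs x' y' hx'D hy'C, hx'r', hy'c', hp'r', hp'x', hq'c', hq'y', hAp', hAq',
      hx', hy'⟩

end AdditiveFootprintIncidence
end Summit.Ventures.HSemireg
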